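import Literature.Analysis.FluidPDE.FlatSwirlGauge
import Summits.NavierStokesRegularity.NavierStokesRegularity.Theses.FlatSwirlGauge

/-!
# Route FlatSwirlGauge — the hardness sandwich of the crux `CriticalSwirlRegularity`

Negative-side (dossier) support file for the crux `CriticalSwirlRegularity` (CSR, item
`stmt-NavierStokesRegularity-1253`, route `FlatSwirlGauge` of NavierStokesRegularity), written by the line lead
(continuation c4) of the dead line `registered` (`Cruxes/CriticalSwirlRegularity/Lines/registered-dead*.md`),
next to the rest-state witnesses of leads c1–c3 in this directory. It records, as two machine-checked
implications instead of prose, WHERE the crux sits — what a refutation must be and what a proof must contain: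

* **Upper bound (irrefutability).** `criticalSwirlRegularity_of_noBlowup`: the no-blow-up statement for
  classical Leray–Hopf solutions from rapidly decaying data — verbatim the HYPOTHESIS of the route's own support
  `NoBlowupToClay` (item `stmt-NavierStokesRegularity-0055`) — implies CSR. Hence a refutation `¬ CSR` is a
  finite-time blow-up of a classical Leray–Hopf solution from a rapidly decaying datum; no rest-state or
  smooth-background witness (the currency of the `Negative/` files of this crux) can ever refute the crux itself.
  The only analysis used is `bounded_near_of_hasSmoothExtensionPast`: a classical extension to `[0, T')`,
  `T' > T`, is jointly continuous, hence bounded on the compact `[0, T] × B̄₁(x₀)`.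
* **Lower bound (hardness).** `bounded_of_criticalSwirlRegularity_of_axisymmetric`: CSR implies LOCAL
  REGULARITY OF AXISYMMETRIC FLOWS IN THE SWIRL-DOMINATED REGIME — for a classical Leray–Hopf solution on
  `[0, T)` from a rapidly decaying datum with axisymmetric velocity and pressure, if on a backward cylinder
  `Q_ρ(T, x₀)` the swirl `Γ = r u_θ` is bounded and `‖ω‖ r ≤ C ‖∇Γ‖`, then `u` is bounded near `(T, x₀)`. This is
  the exactly-flat shadow of the crux (the in-tree anchor
  `Literature.Analysis.FluidPDE.IsClassicalNSSolutionOn.hasFlatSwirlGauge_of_axisymmetric`, KNSS 2009 eq. (1.8)):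
  a localized axisymmetric-with-swirl regularity statement for which nothing in print gives a proof without a
  rate or modulus hypothesis (KNSS 2009 §5; Lei–Zhang 2017; Wei 2016; Chen–Fang–Zhang 2017 all assume one).

Together: `NoBlowup ⟹ CSR ⟹ (localized axisymmetric swirl-dominated regularity)`; both neighbours are open, so
every line for CSR must contain a stub at least as hard as the right-hand side, and no line can be killed by
refuting CSR. Nothing here is new mathematics.

## References

* G. Koch, N. Nadirashvili, G. Seregin, V. Šverák, *Liouville theorems for the Navier–Stokes equations and
  applications*, Acta Math. 203 (2009) 83–105, eq. (1.8) and §5. [KNSS2009]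
* J. T. Beale, T. Kato, A. Majda, *Remarks on the breakdown of smooth solutions for the 3-D Euler
  equations*, Comm. Math. Phys. 94 (1984), §1 (continuation vocabulary). [BealeKatoMajda1984]
-/

namespace Summit.NavierStokesRegularity.NavierStokesRegularity.Theorems.CriticalSwirlRegularity.Negative

open Literature.Analysis.FluidPDE Set Metric

/-- **A classical extension past `T` is bounded near every `(T, x₀)`.** If the velocity `u` on `[0, T)`
extends to a classical solution on some `[0, T')`, `T' > T` (`HasSmoothExtensionPast`), then for every
`x₀` there are `r > 0` and `K` with `‖u t x‖ ≤ K` for `t ∈ (T − r², T)`, `t ≥ 0`, `x ∈ B_r(x₀)`: the extension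
is jointly smooth, hence continuous, hence bounded on the compact set `[0, T] × B̄₁(x₀) ⊆ [0, T') × ℝ³`, and
it agrees with `u` on `[0, T)` (Beale–Kato–Majda 1984, §1, continuation vocabulary; elementary). [folklore] -/
theorem bounded_near_of_hasSmoothExtensionPast {ν T : ℝ}
    {u : ℝ → EuclideanSpace ℝ (Fin 3) → EuclideanSpace ℝ (Fin 3)}
    (h : HasSmoothExtensionPast ν 0 u T) (x₀ : EuclideanSpace ℝ (Fin 3)) :
    ∃ r : ℝ, 0 < r ∧ ∃ K : ℝ, ∀ t ∈ Set.Ioo (T - r ^ 2) T, 0 ≤ t →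
      ∀ x ∈ Metric.ball x₀ r, ‖u t x‖ ≤ K := by
  obtain ⟨T', hTT', u', p', hcl, hagree⟩ := h
  set S : Set (ℝ × EuclideanSpace ℝ (Fin 3)) := Set.Icc 0 T ×ˢ Metric.closedBall x₀ 1 with hS
  have hScpt : IsCompact S := isCompact_Icc.prod (isCompact_closedBall x₀ 1)
  have hSsub : S ⊆ Set.Ico 0 T' ×ˢ (Set.univ : Set (EuclideanSpace ℝ (Fin 3))) := by
    rintro ⟨t, x⟩ ⟨ht, -⟩
    exact ⟨⟨ht.1, lt_of_le_of_lt ht.2 hTT'⟩, Set.mem_univ _⟩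
  have hcont : ContinuousOn (Function.uncurry u') S :=
    (hcl.smooth_velocity.continuousOn).mono hSsub
  obtain ⟨K, hK⟩ := hScpt.exists_bound_of_continuousOn hcont
  refine ⟨1, one_pos, K, fun t ht ht0 x hx => ?_⟩
  have htx : (t, x) ∈ S := ⟨⟨ht0, ht.2.le⟩, Metric.ball_subset_closedBall hx⟩
  have hux : u' t x = u t x := by rw [hagree t ⟨ht0, ht.2⟩]
  simpa [Function.uncurry, hux] using hK (t, x) htx

/-- **Upper bound of the sandwich: no blow-up implies `CriticalSwirlRegularity`.** If every classical
Leray–Hopf solution on `[0, T)` from a rapidly decaying datum extends smoothly past `T` (verbatim the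
hypothesis of the route's support `NoBlowupToClay`, item `stmt-NavierStokesRegularity-0055`), then the crux
`CriticalSwirlRegularity` holds — the gauge hypothesis is not even used. Consequently `¬ CriticalSwirlRegularity`
would exhibit a finite-time blow-up from a rapidly decaying datum: the crux is irrefutable short of a negative
answer to the regularity problem, and in particular by no rest-state / smooth-background witness. [folklore] -/
theorem criticalSwirlRegularity_of_noBlowup
    (hNB : ∀ (ν T : ℝ), 0 < ν → 0 < T →
      ∀ (u : ℝ → EuclideanSpace ℝ (Fin 3) → EuclideanSpace ℝ (Fin 3))
        (p : ℝ → EuclideanSpace ℝ (Fin 3) → ℝ),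
        IsClassicalNSSolutionOn (Set.Ico 0 T) ν 0 u p → IsLerayHopfOn T ν 0 (u 0) u →
          HasRapidSpatialDecay (u 0) → HasSmoothExtensionPast ν 0 u T) :
    Summit.NavierStokesRegularity.NavierStokesRegularity.Theses.FlatSwirlGauge.CriticalSwirlRegularity := by
  intro ν T hν hT u p hcl hLH hdec x₀ _hgauge
  exact bounded_near_of_hasSmoothExtensionPast (hNB ν T hν hT u p hcl hLH hdec) x₀

/-- **`CriticalSwirlRegularity` restated over the packaged notion `HasFlatSwirlGauge`** (the gauge
hypothesis of the crux IS `HasFlatSwirlGauge ν u T x₀`, `hasFlatSwirlGauge_iff` being `Iff.rfl`): the crux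
says that a classical Leray–Hopf solution from a rapidly decaying datum which admits a flat swirl gauge at
`(T, x₀)` is bounded near `(T, x₀)`. Definitional (`Iff.rfl`). [folklore] -/
theorem criticalSwirlRegularity_iff_hasFlatSwirlGauge :
    Summit.NavierStokesRegularity.NavierStokesRegularity.Theses.FlatSwirlGauge.CriticalSwirlRegularity ↔
      ∀ (ν T : ℝ), 0 < ν → 0 < T →
        ∀ (u : ℝ → EuclideanSpace ℝ (Fin 3) → EuclideanSpace ℝ (Fin 3))
          (p : ℝ → EuclideanSpace ℝ (Fin 3) → ℝ),
          IsClassicalNSSolutionOn (Set.Ico 0 T) ν 0 u p → IsLerayHopfOn T ν 0 (u 0) u →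
            HasRapidSpatialDecay (u 0) → ∀ x₀ : EuclideanSpace ℝ (Fin 3),
              HasFlatSwirlGauge ν u T x₀ →
                ∃ r : ℝ, 0 < r ∧ ∃ K : ℝ, ∀ t ∈ Set.Ioo (T - r ^ 2) T, 0 ≤ t →
                  ∀ x ∈ Metric.ball x₀ r, ‖u t x‖ ≤ K :=
  Iff.rfl

/-- **Lower bound of the sandwich: `CriticalSwirlRegularity` implies localized regularity of axisymmetric
flows in the swirl-dominated regime.** Assume the crux. Let `(u, p)` be a classical Navier–Stokes solution on
`ℝ³ × [0, T)` (`ν > 0`, no force), Leray–Hopf from a rapidly decaying datum, with axisymmetric velocity and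
pressure, and let `Q_ρ(T, x₀) = (T − ρ², T) × B_ρ(x₀)` (`0 < ρ`, `ρ² < T`) be a backward cylinder on which the
swirl `Γ = swirl (u t) = r u_θ` satisfies `|Γ| ≤ M` and the poloidal/swirl-dominance bound
`‖curl u‖ r ≤ C ‖∇Γ‖`. Then `u` is bounded on some `(T − r², T) × B_r(x₀)`. Proof: by the in-tree anchor
`IsClassicalNSSolutionOn.hasFlatSwirlGauge_of_axisymmetric` (KNSS 2009, eq. (1.8): `α = Γ`, `b = −(2/r)e_r`,
`d = r`) the flow admits a flat swirl gauge at `(T, x₀)`, and the crux applies. This exactly-flat shadow is a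
localized axisymmetric-with-swirl regularity statement with NO rate / modulus hypothesis on `Γ`, for which
print offers no proof (KNSS 2009 §5, Lei–Zhang 2017, Wei 2016, Chen–Fang–Zhang 2017 all need one): every
line for the crux contains a stub at least this hard. [cite: KNSS2009, eq. (1.8)] -/
theorem bounded_of_criticalSwirlRegularity_of_axisymmetric
    (hCSR : Summit.NavierStokesRegularity.NavierStokesRegularity.Theses.FlatSwirlGauge.CriticalSwirlRegularity)
    {ν T : ℝ} (hν : 0 < ν) (hT : 0 < T)
    {u : ℝ → EuclideanSpace ℝ (Fin 3) → EuclideanSpace ℝ (Fin 3)} {p : ℝ → EuclideanSpace ℝ (Fin 3) → ℝ}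
    (h : IsClassicalNSSolutionOn (Set.Ico 0 T) ν 0 u p) (hLH : IsLerayHopfOn T ν 0 (u 0) u)
    (hdec : HasRapidSpatialDecay (u 0))
    (hu : ∀ t ∈ Set.Ico 0 T, IsAxisymmetric (u t)) (hp : ∀ t ∈ Set.Ico 0 T, IsAxisymmetricScalar (p t))
    {x₀ : EuclideanSpace ℝ (Fin 3)} {ρ C M : ℝ} (hρ : 0 < ρ) (hρT : ρ ^ 2 < T)
    (hM : ∀ t ∈ Set.Ioo (T - ρ ^ 2) T, ∀ x ∈ Metric.ball x₀ ρ, |swirl (u t) x| ≤ M)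
    (hω : ∀ t ∈ Set.Ioo (T - ρ ^ 2) T, ∀ x ∈ Metric.ball x₀ ρ,
      ‖curl (u t) x‖ * cylRadius x ≤ C * ‖gradient (swirl (u t)) x‖) :
    ∃ r : ℝ, 0 < r ∧ ∃ K : ℝ, ∀ t ∈ Set.Ioo (T - r ^ 2) T, 0 ≤ t →
      ∀ x ∈ Metric.ball x₀ r, ‖u t x‖ ≤ K :=
  criticalSwirlRegularity_iff_hasFlatSwirlGauge.1 hCSR ν T hν hT u p h hLH hdec x₀
    (h.hasFlatSwirlGauge_of_axisymmetric hu hp hρ hρT hM hω)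

end Summit.NavierStokesRegularity.NavierStokesRegularity.Theorems.CriticalSwirlRegularity.Negative
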